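import Mathlib.Analysis.SpecialFunctions.Integrals.Basic
import Mathlib.Analysis.SpecialFunctions.Pow.Real
import Mathlib.Analysis.Complex.ExponentialBounds
import Mathlib.MeasureTheory.Integral.IntervalIntegral.FundThmCalculus
import HarnessLib

/-!
# Majorants for the explicit linear sieve: Nathanson's `h`, `H`, `α` (Lemma 9.6) and their numerics

Topic `Literature/NumberTheory/Sieve`; second file of the explicit form of the Jurkat–Richert
theorem following M. B. Nathanson, *Additive Number Theory: The Classical Bases*, GTM 164 (1996),
Ch. 9, §9.3 (PDF pp. 156–157 of the held copy) [Nathanson1996]. Everything here is elementary real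
analysis and is PROVED; no sieve enters.

Nathanson majorises the continuous models `f_n(s)` of the boundary sums by `2e² α^{n−1} h(s)`
(Lemma 9.7) and runs the induction of Theorem 9.5 with the error majorant
`h_n(s) = (K − 1) τ^n e^{10} h(s)`, where (9.23)
`h(s) = e^{−2}` (`1 ≤ s ≤ 2`), `= e^{−s}` (`2 ≤ s ≤ 3`), `= 3 s^{−1} e^{−s}` (`s ≥ 3`),
`H(s) = ∫_s^∞ h(t − 1) dt`, `α = H(2)/(2h(2)) = 1 − 1/(2e) + (3e²/2) ∫_3^∞ e^{−t} t^{−1} dt = 0.96068…`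
(9.24), and Lemma 9.6: `H(s) ≤ α s h(s)` (`s ≥ 2`), `H(3) ≤ α s h(s)` (`1 ≤ s ≤ 3`).

## What is proved, and two deviations from the printed bookkeeping

* `JurkatRichert.hFun = h` ((9.23), written `e^{−max(s,2)} · 3/max(s,3)`, so continuous and
  non-increasing on `ℝ`), with `h(s − 1) ≤ 4 h(s)` (Exercise 8), `h ≤ e^{−s}`, `e^{−3} ≤ h` on `s ≤ 3`.
* The exponential integral is avoided: `∫_a^T e^{−t}/t dt ≤ e^{−a} R(a)`,
  `R(x) = (x² + 5x + 2)/(x(x² + 6x + 6))` (the fifth convergent of the continued fraction of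
  `e^x E₁(x)`; `−(e^{−x} R)' = e^{−x}(1/x + 12/(x(x² + 6x + 6))²) ≥ e^{−x}/x`), whence
  `∫_3^∞ e^{−t}/t dt ≤ (26/99) e^{−3} = 0.013075…` (true value `0.013048…`), and we WORK WITH
  `α := 1 − 7/(66e) = 0.96098…` (`JurkatRichert.alphaN`), the value of Nathanson's expression for
  `α` with the integral replaced by this bound (so `α ≥` Nathanson's `0.96068`); Lemma 9.6 is proved
  for it in the finite form `∫_{s−1}^T h ≤ α s h(s)` (`s ≥ 2`, all `T`) and `∫_2^T h ≤ α s h(s)`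
  (`1 ≤ s ≤ 3`) (`H(s) = ∫_{s−1}^∞ h`).
* ERRATUM in the proof of Theorem 9.5 (Nathanson p. 256, last paragraph): for odd `n ≥ 3` and
  `1 ≤ s < 3` the recursion (9.15) runs over `p < D^{1/3} < z` and Lemma 9.8 then yields the factor
  `V(D^{1/3})`, not `V(z)`; since `V(D^{1/3}) ≥ V(z)` the displayed `< (f_n(3) + h_n(3)) V(z)` does not
  follow. The correct route (`T_n(D, z) = T_n(D, D^{1/3})` and `V(D^{1/3}) ≤ (3K/s) V(z)`) costs a
  factor `3K/s`, and Nathanson's invariant `T_n < V(z)(f_n(s) + h_n(s))` is then NOT propagated for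
  `s < 3/e` (it would need `3e^{−3}/s ≤ h(s) = e^{−2}`). The induction of the tree
  (`JurkatRichertInduction.lean`) therefore uses TWO majorant shapes: `h` for even `n` and, for odd
  `n`, `m_o(s) = 3 e^{−max(s,3)}/max(s,1)` (`JurkatRichert.moFun`; `= 3e^{−3}/s` on `[1, 3]`, `= h` on
  `[3, ∞)`), for which this file proves the transfer inequalities
  `∫_{s−1}^T m_o ≤ (9/10) s h(s)` (`s ≥ 2`) and `∫_{s−1}^T h ≤ (9/10) s m_o(s)` (`s ≥ 3`) and the shift
  bounds `m_o(s−1) ≤ 4 h(s)`, `h(s−1) ≤ 4 m_o(s)`, `h ≤ e m_o`. The final theorem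
  (`(F(s) + ε e^{14−s}) X + R`) is unchanged.

## References

* M. B. Nathanson, *Additive Number Theory: The Classical Bases*, GTM 164, Springer (1996), Ch. 9,
  (9.23)–(9.26), Lemma 9.6, Exercise 8, and the proof of Theorem 9.5. [Nathanson1996]
-/

open Set MeasureTheory intervalIntegral Real

noncomputable section

namespace Literature.NumberTheory.Sieve

namespace JurkatRichert

/-! ### Nathanson's majorant `h` (9.23) and the odd-index majorant `m_o` -/

/-- Nathanson's `h(s)` ((9.23)): `e^{−2}` for `s ≤ 2`, `e^{−s}` for `2 ≤ s ≤ 3`, `3e^{−s}/s` for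
`s ≥ 3`; written in the closed form `e^{−max(s,2)} · (3/max(s,3))` (continuous, non-increasing on
`ℝ`; the values for `s < 1` are never used). [cite: Nathanson1996, (9.23)] -/
def hFun (s : ℝ) : ℝ :=
  Real.exp (-max s 2) * (3 / max s 3)

/-- The odd-index majorant `m_o(s) = 3 e^{−max(s,3)}/max(s,1)`: `3e^{−3}/s` on `[1, 3]` (so that
`m_o(s) = (3/s) m_o(3)`, absorbing the factor `log z/log D^{1/3} = 3/s` of the erratum described in
the module docstring) and `= h(s)` for `s ≥ 3`. [folklore] -/
def moFun (s : ℝ) : ℝ :=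
  3 * Real.exp (-max s 3) / max s 1

/-- `h(s) = e^{−2}` for `s ≤ 2`. [cite: Nathanson1996, (9.23)] -/
theorem hFun_of_le_two {s : ℝ} (hs : s ≤ 2) : hFun s = Real.exp (-2) := by
  rw [hFun, max_eq_right hs, max_eq_right (by linarith)]; norm_num

/-- `h(s) = e^{−s}` for `2 ≤ s ≤ 3`. [cite: Nathanson1996, (9.23)] -/
theorem hFun_of_mem {s : ℝ} (h2 : 2 ≤ s) (h3 : s ≤ 3) : hFun s = Real.exp (-s) := by
  rw [hFun, max_eq_left h2, max_eq_right h3]; norm_num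

/-- `h(s) = 3e^{−s}/s` for `s ≥ 3`. [cite: Nathanson1996, (9.23)] -/
theorem hFun_of_three_le {s : ℝ} (h3 : 3 ≤ s) : hFun s = 3 * Real.exp (-s) / s := by
  rw [hFun, max_eq_left (by linarith), max_eq_left h3]; ring

/-- `m_o(s) = 3e^{−3}/s` for `1 ≤ s ≤ 3`. [folklore] -/
theorem moFun_of_mem {s : ℝ} (h1 : 1 ≤ s) (h3 : s ≤ 3) : moFun s = 3 * Real.exp (-3) / s := by
  rw [moFun, max_eq_right h3, max_eq_left h1]

/-- `m_o(s) = 3e^{−s}/s = h(s)` for `s ≥ 3`. [folklore] -/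
theorem moFun_of_three_le {s : ℝ} (h3 : 3 ≤ s) : moFun s = 3 * Real.exp (-s) / s := by
  rw [moFun, max_eq_left h3, max_eq_left (by linarith)]

/-- `m_o = h` on `[3, ∞)`. [folklore] -/
theorem moFun_eq_hFun {s : ℝ} (h3 : 3 ≤ s) : moFun s = hFun s := by
  rw [moFun_of_three_le h3, hFun_of_three_le h3]

/-- `m_o(3) = e^{−3}`. [folklore] -/
theorem moFun_three : moFun 3 = Real.exp (-3) := by
  rw [moFun_of_three_le le_rfl]; ring

/-- The scaling `m_o(s) = (3/s) m_o(3)` on `[1, 3]`. [folklore] -/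
theorem moFun_eq_div_mul {s : ℝ} (h1 : 1 ≤ s) (h3 : s ≤ 3) : moFun s = 3 / s * moFun 3 := by
  rw [moFun_of_mem h1 h3, moFun_three]; ring

/-- `h > 0`. [folklore] -/
theorem hFun_pos (s : ℝ) : 0 < hFun s := by
  unfold hFun
  have : (0 : ℝ) < max s 3 := lt_of_lt_of_le (by norm_num) (le_max_right _ _)
  positivity

/-- `m_o > 0`. [folklore] -/
theorem moFun_pos (s : ℝ) : 0 < moFun s := by
  unfold moFun
  have : (0 : ℝ) < max s 1 := lt_of_lt_of_le (by norm_num) (le_max_right _ _)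
  positivity

/-- `h` is continuous. [folklore] -/
theorem continuous_hFun : Continuous hFun := by
  unfold hFun
  refine ((continuous_id.max continuous_const).neg.rexp).mul ?_
  refine continuous_const.div (continuous_id.max continuous_const) fun s => ?_
  exact ne_of_gt (lt_of_lt_of_le (by norm_num) (le_max_right _ _))

/-- `m_o` is continuous. [folklore] -/
theorem continuous_moFun : Continuous moFun := by
  unfold moFun
  refine (continuous_const.mul (continuous_id.max continuous_const).neg.rexp).div
    (continuous_id.max continuous_const) fun s => ?_
  exact ne_of_gt (lt_of_lt_of_le (by norm_num) (le_max_right _ _))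

/-- `h` is non-increasing (on all of `ℝ`). [cite: Nathanson1996, §9.3 (after (9.23))] -/
theorem antitone_hFun : Antitone hFun := by
  intro a b hab
  unfold hFun
  have ha3 : (0 : ℝ) < max a 3 := lt_of_lt_of_le (by norm_num) (le_max_right _ _)
  have hb3 : (0 : ℝ) < max b 3 := lt_of_lt_of_le (by norm_num) (le_max_right _ _)
  have h1 : Real.exp (-max b 2) ≤ Real.exp (-max a 2) :=
    Real.exp_le_exp.mpr (neg_le_neg (max_le_max hab le_rfl))
  have h2 : 3 / max b 3 ≤ 3 / max a 3 :=
    div_le_div_of_nonneg_left (by norm_num) ha3 (max_le_max hab le_rfl)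
  exact mul_le_mul h1 h2 (by positivity) (Real.exp_pos _).le

/-- `m_o` is non-increasing (on all of `ℝ`). [folklore] -/
theorem antitone_moFun : Antitone moFun := by
  intro a b hab
  unfold moFun
  have ha1 : (0 : ℝ) < max a 1 := lt_of_lt_of_le (by norm_num) (le_max_right _ _)
  have h1 : Real.exp (-max b 3) ≤ Real.exp (-max a 3) :=
    Real.exp_le_exp.mpr (neg_le_neg (max_le_max hab le_rfl))
  rw [div_le_div_iff₀ (lt_of_lt_of_le (by norm_num) (le_max_right _ _)) ha1]
  have h2 : max a 1 ≤ max b 1 := max_le_max hab le_rfl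
  have h3 : 0 ≤ Real.exp (-max b 3) := (Real.exp_pos _).le
  nlinarith [mul_le_mul h1 h2 ha1.le (Real.exp_pos _).le]

/-- `h(s) ≤ e^{−s}` (for all `s`). [cite: Nathanson1996, Thm 9.5 (proof: "h(s) ≤ e^{−s} for all s ≥ 1")] -/
theorem hFun_le_exp_neg (s : ℝ) : hFun s ≤ Real.exp (-s) := by
  unfold hFun
  have h3 : (3 : ℝ) ≤ max s 3 := le_max_right _ _
  have h3' : (0 : ℝ) < max s 3 := by linarith
  have hdiv : 3 / max s 3 ≤ 1 := (div_le_one h3').mpr h3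
  have hexp : Real.exp (-max s 2) ≤ Real.exp (-s) := Real.exp_le_exp.mpr (neg_le_neg (le_max_left _ _))
  calc Real.exp (-max s 2) * (3 / max s 3) ≤ Real.exp (-s) * 1 :=
        mul_le_mul hexp hdiv (by positivity) (Real.exp_pos _).le
    _ = Real.exp (-s) := mul_one _

/-- `e^{−3} ≤ h(s)` for `s ≤ 3`. [cite: Nathanson1996, Thm 9.5 (proof: "h(s) ≥ e^{−3}")] -/
theorem exp_neg_three_le_hFun {s : ℝ} (hs : s ≤ 3) : Real.exp (-3) ≤ hFun s := by
  rw [hFun, max_eq_right hs, div_self (by norm_num : (3 : ℝ) ≠ 0), mul_one]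
  exact Real.exp_le_exp.mpr (neg_le_neg (max_le hs (by norm_num)))

/-- `h(s) ≤ e^{−2}`. [folklore] -/
theorem hFun_le_exp_neg_two (s : ℝ) : hFun s ≤ Real.exp (-2) := by
  have h := antitone_hFun (min_le_left s 2)
  rwa [hFun_of_le_two (min_le_right s 2)] at h

/-- `e^{−3} ≤ m_o(s)` for `s ≤ 3`. [folklore] -/
theorem exp_neg_three_le_moFun {s : ℝ} (hs : s ≤ 3) : Real.exp (-3) ≤ moFun s := by
  have h := antitone_moFun hs
  rwa [moFun_three] at h

/-- `h ≤ e · m_o` (used to convert Lemma 9.7's bound `f_n ≤ 2e² α^{n−1} h` to the odd majorant: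
on `s ≤ 3`, `h ≤ e^{−2} = e · e^{−3} ≤ e m_o`; on `s ≥ 3`, `h = m_o`). [folklore] -/
theorem hFun_le_exp_one_mul_moFun (s : ℝ) : hFun s ≤ Real.exp 1 * moFun s := by
  rcases le_or_gt s 3 with hs | hs
  · calc hFun s ≤ Real.exp (-2) := hFun_le_exp_neg_two s
      _ = Real.exp 1 * Real.exp (-3) := by rw [← Real.exp_add]; norm_num
      _ ≤ Real.exp 1 * moFun s :=
          mul_le_mul_of_nonneg_left (exp_neg_three_le_moFun hs) (Real.exp_pos _).le
  · rw [moFun_eq_hFun hs.le]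
    have h1 : 1 ≤ Real.exp 1 := Real.one_le_exp (by norm_num)
    nlinarith [hFun_pos s]

/-! ### Numerical constants: `e`, `e⁻¹` -/

/-- `2.718281828 < e < 2.718281829`. [folklore] -/
theorem exp_one_bounds : 2.718281828 < Real.exp 1 ∧ Real.exp 1 < 2.718281829 :=
  ⟨lt_trans (by norm_num) Real.exp_one_gt_d9, Real.exp_one_lt_d9.trans (by norm_num)⟩

/-- `0.367879441 < e⁻¹ < 0.367879442`. [folklore] -/
theorem exp_neg_one_bounds : 0.367879441 < Real.exp (-1) ∧ Real.exp (-1) < 0.367879442 :=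
  ⟨lt_trans (by norm_num) Real.exp_neg_one_gt_d9, Real.exp_neg_one_lt_d9.trans (by norm_num)⟩

/-- `e^{x} ≤ 1 + x + x²/2 + 2x³/9` for `0 ≤ x ≤ 1` (`Real.exp_bound'` with `n = 3`). [folklore] -/
theorem exp_le_cubic {x : ℝ} (h0 : 0 ≤ x) (h1 : x ≤ 1) :
    Real.exp x ≤ 1 + x + x ^ 2 / 2 + 2 * x ^ 3 / 9 := by
  have h := Real.exp_bound' h0 h1 (n := 3) (by norm_num)
  have hs : ∑ m ∈ Finset.range 3, x ^ m / (m.factorial : ℝ) = 1 + x + x ^ 2 / 2 := by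
    simp [Finset.sum_range_succ, Nat.factorial]
  rw [hs] at h
  have h3 : (Nat.factorial 3 : ℝ) = 6 := by norm_num [Nat.factorial]
  rw [h3] at h
  have : x ^ 3 * ((3 : ℕ) + 1 : ℝ) / (6 * (3 : ℕ)) = 2 * x ^ 3 / 9 := by push_cast; ring
  linarith [this]

/-- `1/(1 + y + y²/2 + 2y³/9) ≤ e^{−y}` for `0 ≤ y ≤ 1`. [folklore] -/
theorem inv_cubic_le_exp_neg {y : ℝ} (h0 : 0 ≤ y) (h1 : y ≤ 1) :
    1 / (1 + y + y ^ 2 / 2 + 2 * y ^ 3 / 9) ≤ Real.exp (-y) := by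
  have hpos : 0 < 1 + y + y ^ 2 / 2 + 2 * y ^ 3 / 9 := by positivity
  rw [Real.exp_neg, one_div, inv_le_inv₀ hpos (Real.exp_pos _)]
  exact exp_le_cubic h0 h1

/-- `1 + x + x²/2 + x³/6 ≤ e^{x}` for `x ≥ 0` (`Real.sum_le_exp_of_nonneg` with four terms).
[folklore] -/
theorem cubic_le_exp {x : ℝ} (h0 : 0 ≤ x) : 1 + x + x ^ 2 / 2 + x ^ 3 / 6 ≤ Real.exp x := by
  have h := Real.sum_le_exp_of_nonneg h0 4
  have hs : ∑ i ∈ Finset.range 4, x ^ i / (i.factorial : ℝ) = 1 + x + x ^ 2 / 2 + x ^ 3 / 6 := by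
    simp [Finset.sum_range_succ, Nat.factorial]
  linarith [hs]

/-! ### The exponential integral: `∫_a^T e^{−t}/t dt ≤ e^{−a} R(a)` -/

/-- `R(x) = (x² + 5x + 2)/(x(x² + 6x + 6))`, the fifth convergent of the S-fraction of `e^x E₁(x)`
(an upper bound for it). [folklore] -/
def expIntBound (x : ℝ) : ℝ :=
  (x ^ 2 + 5 * x + 2) / (x * (x ^ 2 + 6 * x + 6))

/-- `R(3) = 26/99`. [folklore] -/
theorem expIntBound_three : expIntBound 3 = 26 / 99 := by norm_num [expIntBound]

/-- `0 ≤ R(x)` for `x > 0`. [folklore] -/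
theorem expIntBound_nonneg {x : ℝ} (hx : 0 < x) : 0 ≤ expIntBound x := by
  unfold expIntBound; positivity

/-- `R(x) ≤ 26/99` for `x ≥ 3` (`R` is decreasing; here the polynomial inequality
`99(x² + 5x + 2) ≤ 26 x (x² + 6x + 6)` on `[3, ∞)`). [folklore] -/
theorem expIntBound_le {x : ℝ} (hx : 3 ≤ x) : expIntBound x ≤ 26 / 99 := by
  unfold expIntBound
  have hpos : 0 < x * (x ^ 2 + 6 * x + 6) := by positivity
  rw [div_le_div_iff₀ hpos (by norm_num)]
  nlinarith [mul_nonneg (mul_nonneg (by linarith : (0 : ℝ) ≤ x - 3) (by linarith : (0 : ℝ) ≤ x))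
    (by linarith : (0 : ℝ) ≤ x)]

/-- The derivative of `U(x) = e^{−x} R(x)`: `U'(x) = −e^{−x}(1/x + 12/(x(x² + 6x + 6))²)` for
`x > 0`. [folklore] -/
theorem hasDerivAt_expIntBound {x : ℝ} (hx : 0 < x) :
    HasDerivAt (fun t => Real.exp (-t) * expIntBound t)
      (-(Real.exp (-x) * (1 / x + 12 / (x * (x ^ 2 + 6 * x + 6)) ^ 2))) x := by
  have hM : x * (x ^ 2 + 6 * x + 6) ≠ 0 := by positivity
  have hsq : HasDerivAt (fun t : ℝ => t ^ 2) (2 * x) x := by simpa using hasDerivAt_pow 2 x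
  have hN : HasDerivAt (fun t : ℝ => t ^ 2 + 5 * t + 2) (2 * x + 5) x := by
    have h5 : HasDerivAt (fun t : ℝ => 5 * t) 5 x := by
      simpa using (hasDerivAt_id x).const_mul (5 : ℝ)
    simpa using (hsq.add h5).add_const (2 : ℝ)
  have hMd : HasDerivAt (fun t : ℝ => t * (t ^ 2 + 6 * t + 6)) (3 * x ^ 2 + 12 * x + 6) x := by
    have h6 : HasDerivAt (fun t : ℝ => 6 * t) 6 x := by
      simpa using (hasDerivAt_id x).const_mul (6 : ℝ)
    have h1 : HasDerivAt (fun t : ℝ => t ^ 2 + 6 * t + 6) (2 * x + 6) x := by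
      simpa using (hsq.add h6).add_const (6 : ℝ)
    have h2 := (hasDerivAt_id x).mul h1
    refine h2.congr_deriv ?_
    simp only [id]
    ring
  have hR : HasDerivAt expIntBound
      (((2 * x + 5) * (x * (x ^ 2 + 6 * x + 6)) - (x ^ 2 + 5 * x + 2) * (3 * x ^ 2 + 12 * x + 6)) /
        (x * (x ^ 2 + 6 * x + 6)) ^ 2) x := by
    have := hN.div hMd hM
    exact this
  have hE : HasDerivAt (fun t => Real.exp (-t)) (-Real.exp (-x)) x := by
    have := (hasDerivAt_neg x).exp
    simpa using this
  have h := hE.mul hR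
  refine h.congr_deriv ?_
  simp only [expIntBound]
  field_simp
  ring

/-- **Upper bound for the exponential integral**: `∫_a^T e^{−t}/t dt ≤ e^{−a} R(a)` for `0 < a ≤ T`
(integrate `e^{−t}/t ≤ −(e^{−t} R(t))'` and drop `e^{−T} R(T) ≥ 0`). In particular
`∫_3^∞ e^{−t}/t dt ≤ (26/99) e^{−3} = 0.01307…` (true value `0.013048…`). [folklore] -/
theorem integral_exp_neg_div_le {a T : ℝ} (ha : 0 < a) (haT : a ≤ T) :
    ∫ t in a..T, Real.exp (-t) / t ≤ Real.exp (-a) * expIntBound a := by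
  set U : ℝ → ℝ := fun t => Real.exp (-t) * expIntBound t with hU
  set u : ℝ → ℝ := fun x => Real.exp (-x) * (1 / x + 12 / (x * (x ^ 2 + 6 * x + 6)) ^ 2) with hu
  have hderiv : ∀ x ∈ Icc a T, HasDerivAt U (-u x) x := fun x hx =>
    hasDerivAt_expIntBound (ha.trans_le hx.1)
  have hcontU : ContinuousOn U (Icc a T) := fun x hx => (hderiv x hx).continuousAt.continuousWithinAt
  have hu_cont : ContinuousOn u (Icc a T) := by
    refine (Real.continuous_exp.comp continuous_neg).continuousOn.mul ?_
    refine ContinuousOn.add ?_ ?_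
    · exact continuousOn_const.div continuousOn_id fun x hx => (ha.trans_le hx.1).ne'
    · refine continuousOn_const.div ((continuousOn_id.mul ?_).pow 2) fun x hx => ?_
      · exact ((continuousOn_id.pow 2).add (continuousOn_const.mul continuousOn_id)).add
          continuousOn_const
      · have : 0 < x := ha.trans_le hx.1
        positivity
  have hu_int : IntervalIntegrable u volume a T := by
    refine ContinuousOn.intervalIntegrable ?_
    rwa [uIcc_of_le haT]
  have hFTC : ∫ x in a..T, -u x = U T - U a :=
    integral_eq_sub_of_hasDerivAt_of_le haT hcontU (fun x hx => hderiv x ⟨hx.1.le, hx.2.le⟩)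
      hu_int.neg
  have hint : ∫ x in a..T, u x = U a - U T := by
    rw [intervalIntegral.integral_neg] at hFTC; linarith
  have hUT : 0 ≤ U T := mul_nonneg (Real.exp_pos _).le (expIntBound_nonneg (ha.trans_le haT))
  have hf_int : IntervalIntegrable (fun t => Real.exp (-t) / t) volume a T := by
    refine ContinuousOn.intervalIntegrable ?_
    rw [uIcc_of_le haT]
    exact (Real.continuous_exp.comp continuous_neg).continuousOn.div continuousOn_id
      fun x hx => (ha.trans_le hx.1).ne'
  calc ∫ t in a..T, Real.exp (-t) / t ≤ ∫ t in a..T, u t := by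
        refine intervalIntegral.integral_mono_on haT hf_int hu_int fun x hx => ?_
        have hx0 : 0 < x := ha.trans_le hx.1
        simp only [hu]
        rw [div_eq_mul_one_div]
        refine mul_le_mul_of_nonneg_left ?_ (Real.exp_pos _).le
        have : 0 ≤ 12 / (x * (x ^ 2 + 6 * x + 6)) ^ 2 := by positivity
        linarith
    _ = U a - U T := hint
    _ ≤ U a := by linarith

/-- `∫_a^T 3e^{−t}/t dt ≤ (26/33) e^{−a}` for `3 ≤ a ≤ T` (`3 R(a) ≤ 3 · 26/99`): the tail of both
majorants beyond `3`. [folklore] -/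
theorem integral_three_mul_exp_neg_div_le {a T : ℝ} (ha : 3 ≤ a) (haT : a ≤ T) :
    ∫ t in a..T, 3 * Real.exp (-t) / t ≤ 26 / 33 * Real.exp (-a) := by
  have h0 : (0 : ℝ) < a := by linarith
  have h1 := integral_exp_neg_div_le h0 haT
  have h2 := expIntBound_le ha
  have heq : ∫ t in a..T, 3 * Real.exp (-t) / t = 3 * ∫ t in a..T, Real.exp (-t) / t := by
    rw [← intervalIntegral.integral_const_mul]
    refine intervalIntegral.integral_congr fun t _ => ?_
    ring
  rw [heq]
  have h3 : Real.exp (-a) * expIntBound a ≤ Real.exp (-a) * (26 / 99) :=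
    mul_le_mul_of_nonneg_left h2 (Real.exp_pos _).le
  linarith

/-! ### Elementary integrals of the majorants -/

/-- `∫_a^b e^{−t} dt = e^{−a} − e^{−b}`. [folklore] -/
theorem integral_exp_neg (a b : ℝ) : ∫ t in a..b, Real.exp (-t) = Real.exp (-a) - Real.exp (-b) := by
  rw [intervalIntegral.integral_comp_neg (fun t => Real.exp t), integral_exp]

/-- Trapezoid bound for the convex function `1/u`: `∫_a^b du/u ≤ (b − a)(1/a + 1/b)/2` for
`0 < a ≤ b` (the chord lies above the graph). [folklore] -/
theorem integral_inv_le_trapezoid {a b : ℝ} (ha : 0 < a) (hab : a ≤ b) :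
    ∫ u in a..b, 1 / u ≤ (b - a) * (1 / a + 1 / b) / 2 := by
  have hb : 0 < b := ha.trans_le hab
  rcases hab.eq_or_lt with rfl | hlt
  · simp
  -- chord `ℓ(u) = (1/a)(b − u)/(b − a) + (1/b)(u − a)/(b − a)`
  set ℓ : ℝ → ℝ := fun u => (1 / a) * ((b - u) / (b - a)) + (1 / b) * ((u - a) / (b - a)) with hℓ
  have hba : 0 < b - a := by linarith
  have hchord : ∀ u ∈ Icc a b, 1 / u ≤ ℓ u := by
    intro u hu
    have hu0 : 0 < u := ha.trans_le hu.1
    simp only [hℓ]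
    have hkey : 0 ≤ (u - a) * (b - u) := mul_nonneg (by linarith [hu.1]) (by linarith [hu.2])
    rw [show 1 / a * ((b - u) / (b - a)) + 1 / b * ((u - a) / (b - a)) =
        (b * (b - u) + a * (u - a)) / (a * b * (b - a)) by field_simp]
    rw [div_le_div_iff₀ hu0 (by positivity)]
    nlinarith [mul_nonneg hkey hba.le]
  have hint1 : IntervalIntegrable (fun u : ℝ => 1 / u) volume a b := by
    refine ContinuousOn.intervalIntegrable ?_
    rw [uIcc_of_le hab]
    exact continuousOn_const.div continuousOn_id fun u hu => (ha.trans_le hu.1).ne'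
  have hint2 : IntervalIntegrable ℓ volume a b := by
    refine Continuous.intervalIntegrable ?_ _ _
    simp only [hℓ]
    fun_prop
  calc ∫ u in a..b, 1 / u ≤ ∫ u in a..b, ℓ u :=
        intervalIntegral.integral_mono_on hab hint1 hint2 hchord
    _ = (b - a) * (1 / a + 1 / b) / 2 := by
        simp only [hℓ]
        set c₁ : ℝ := 1 / (b * (b - a)) - 1 / (a * (b - a)) with hc₁
        set c₀ : ℝ := b / (a * (b - a)) - a / (b * (b - a)) with hc₀
        have e2 : (fun u : ℝ => 1 / a * ((b - u) / (b - a)) + 1 / b * ((u - a) / (b - a))) =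
            fun u : ℝ => c₁ * u + c₀ := by
          funext u; simp only [hc₁, hc₀]; field_simp; ring
        have hi1 : IntervalIntegrable (fun u : ℝ => c₁ * u) volume a b :=
          (continuous_const.mul continuous_id).intervalIntegrable a b
        have hi0 : IntervalIntegrable (fun _ : ℝ => c₀) volume a b := intervalIntegrable_const
        rw [e2, intervalIntegral.integral_add hi1 hi0, intervalIntegral.integral_const_mul, integral_id,
          intervalIntegral.integral_const, smul_eq_mul]
        simp only [hc₁, hc₀]
        field_simp
        ring

/-- `h` is integrable on every interval. [folklore] -/
theorem intervalIntegrable_hFun (a b : ℝ) : IntervalIntegrable hFun volume a b :=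
  continuous_hFun.intervalIntegrable a b

/-- `m_o` is integrable on every interval. [folklore] -/
theorem intervalIntegrable_moFun (a b : ℝ) : IntervalIntegrable moFun volume a b :=
  continuous_moFun.intervalIntegrable a b

/-- Extending the upper limit of the integral of a nonnegative function. [folklore] -/
theorem integral_le_of_le_of_nonneg {f : ℝ → ℝ} (hf : Continuous f) (h0 : ∀ t, 0 ≤ f t)
    {a T T' : ℝ} (ha : a ≤ T) (hT : T ≤ T') : ∫ t in a..T, f t ≤ ∫ t in a..T', f t :=
  intervalIntegral.integral_mono_interval le_rfl ha hT (Filter.Eventually.of_forall fun t => h0 t)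
    (hf.intervalIntegrable _ _)

/-- `∫_a^b h = (b − a) e^{−2}` inside `(−∞, 2]`. [folklore] -/
theorem integral_hFun_of_le_two {a b : ℝ} (hab : a ≤ b) (hb : b ≤ 2) :
    ∫ t in a..b, hFun t = (b - a) * Real.exp (-2) := by
  rw [intervalIntegral.integral_congr (g := fun _ => Real.exp (-2)) fun t ht => ?_]
  · rw [intervalIntegral.integral_const, smul_eq_mul]
  · rw [uIcc_of_le hab] at ht
    exact hFun_of_le_two (ht.2.trans hb)

/-- `∫_a^b h = e^{−a} − e^{−b}` inside `[2, 3]`. [folklore] -/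
theorem integral_hFun_of_mem {a b : ℝ} (ha : 2 ≤ a) (hab : a ≤ b) (hb : b ≤ 3) :
    ∫ t in a..b, hFun t = Real.exp (-a) - Real.exp (-b) := by
  rw [intervalIntegral.integral_congr (g := fun t => Real.exp (-t)) fun t ht => ?_]
  · exact integral_exp_neg a b
  · rw [uIcc_of_le hab] at ht
    exact hFun_of_mem (ha.trans ht.1) (ht.2.trans hb)

/-- `∫_a^T h ≤ (26/33) e^{−a}` for `3 ≤ a ≤ T` (the tail). [folklore] -/
theorem integral_hFun_tail_le {a T : ℝ} (ha : 3 ≤ a) (haT : a ≤ T) :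
    ∫ t in a..T, hFun t ≤ 26 / 33 * Real.exp (-a) := by
  rw [intervalIntegral.integral_congr (g := fun t => 3 * Real.exp (-t) / t) fun t ht => ?_]
  · exact integral_three_mul_exp_neg_div_le ha haT
  · rw [uIcc_of_le haT] at ht
    exact hFun_of_three_le (ha.trans ht.1)

/-- `∫_a^T m_o ≤ (26/33) e^{−a}` for `3 ≤ a ≤ T` (the tail, `m_o = h` there). [folklore] -/
theorem integral_moFun_tail_le {a T : ℝ} (ha : 3 ≤ a) (haT : a ≤ T) :
    ∫ t in a..T, moFun t ≤ 26 / 33 * Real.exp (-a) := by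
  rw [intervalIntegral.integral_congr (g := fun t => 3 * Real.exp (-t) / t) fun t ht => ?_]
  · exact integral_three_mul_exp_neg_div_le ha haT
  · rw [uIcc_of_le haT] at ht
    exact moFun_of_three_le (ha.trans ht.1)

/-- `∫_a^b m_o ≤ 3e^{−3} (b − a)(1/a + 1/b)/2` inside `[1, 3]` (trapezoid). [folklore] -/
theorem integral_moFun_of_mem_le {a b : ℝ} (ha : 1 ≤ a) (hab : a ≤ b) (hb : b ≤ 3) :
    ∫ t in a..b, moFun t ≤ 3 * Real.exp (-3) * ((b - a) * (1 / a + 1 / b) / 2) := by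
  have h0 : 0 < a := by linarith
  rw [intervalIntegral.integral_congr (g := fun t => 3 * Real.exp (-3) * (1 / t)) fun t ht => ?_]
  · rw [intervalIntegral.integral_const_mul]
    exact mul_le_mul_of_nonneg_left (integral_inv_le_trapezoid h0 hab) (by positivity)
  · rw [uIcc_of_le hab] at ht
    rw [moFun_of_mem (ha.trans ht.1) (ht.2.trans hb)]
    ring

/-! ### The constant `α` and its numerics -/

/-- `α := 1 − 7/(66 e) = 0.96098…`: Nathanson's `α = 1 − 1/(2e) + (3e²/2) ∫_3^∞ e^{−t} t^{−1} dt`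
((9.24), `= 0.96068…`) with the exponential integral replaced by its bound `(26/99) e^{−3}`
(`integral_exp_neg_div_le`). [cite: Nathanson1996, (9.24)] -/
def alphaN : ℝ := 1 - 7 / (66 * Real.exp 1)

/-- `0.96 ≤ α ≤ 0.961`. [folklore] -/
theorem alphaN_bounds : 0.96 ≤ alphaN ∧ alphaN ≤ 0.961 := by
  obtain ⟨h1, h2⟩ := exp_one_bounds
  unfold alphaN
  have he : 0 < Real.exp 1 := Real.exp_pos 1
  constructor
  · rw [le_sub_iff_add_le, ← le_sub_iff_add_le', div_le_iff₀ (by positivity)]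
    nlinarith
  · rw [sub_le_iff_le_add, ← sub_le_iff_le_add', le_div_iff₀ (by positivity)]
    nlinarith

/-- `e/3 ≤ α` (the case `s ≥ 3` of Lemma 9.6: `H(s) ≤ e^{1−s} = (es/3) h(s) < α s h(s)`).
[cite: Nathanson1996, Lemma 9.6 (proof)] -/
theorem exp_one_div_three_le_alphaN : Real.exp 1 / 3 ≤ alphaN := by
  obtain ⟨h1, h2⟩ := exp_one_bounds
  have := alphaN_bounds.1
  linarith

/-- `α < 1`. [cite: Nathanson1996, (9.24)] -/
theorem alphaN_lt_one : alphaN < 1 := by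
  have := alphaN_bounds.2; linarith

/-- `0 < α`. [folklore] -/
theorem alphaN_pos : 0 < alphaN := by
  have := alphaN_bounds.1; linarith

/-- The identity behind the choice of `α`: `2α e^{−2} = 2e^{−2} − e^{−3} + (26/33) e^{−3}`, i.e.
`α = H̄(2)/(2h(2))` where `H̄(2) = ∫_1^2 h + ∫_2^3 h + (26/33) e^{−3}` is our bound for `H(2)`.
[cite: Nathanson1996, (9.24)] -/
theorem two_mul_alphaN_mul_exp :
    2 * alphaN * Real.exp (-2) = 2 * Real.exp (-2) - Real.exp (-3) + 26 / 33 * Real.exp (-3) := by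
  unfold alphaN
  have he : Real.exp 1 ≠ 0 := (Real.exp_pos 1).ne'
  have h3 : Real.exp (-3) = Real.exp (-2) * (Real.exp 1)⁻¹ := by
    rw [← Real.exp_neg, ← Real.exp_add]; norm_num
  rw [h3]
  field_simp
  ring


/-! ### Shift bounds: `h(s − 1) ≤ 4 h(s)` (Exercise 8) and its companions for `m_o` -/

/-- `e ≤ 3` and `e ≤ 4` in the forms used below. [folklore] -/
theorem exp_one_lt_three : Real.exp 1 < 3 := lt_trans Real.exp_one_lt_d9 (by norm_num)

/-- **`h(s − 1) ≤ 4 h(s)` for `s ≥ 2`** (Nathanson, Exercise 8; used in the proof of Theorem 9.5 as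
`(K − 1) h_{n−1}(s − 1) < 4(K − 1) h_{n−1}(s)`). [cite: Nathanson1996, §9.3 (after (9.23)), Exercise 8] -/
theorem hFun_sub_one_le {s : ℝ} (hs : 2 ≤ s) : hFun (s - 1) ≤ 4 * hFun s := by
  have he3 := exp_one_lt_three
  rcases le_or_gt s 3 with h3 | h3
  · -- `e^{-2} ≤ e^{1-s} = e · e^{-s} ≤ 4 e^{-s}`
    rw [hFun_of_le_two (by linarith), hFun_of_mem hs h3]
    have h1 : Real.exp (-2) ≤ Real.exp (1 + -s) := Real.exp_le_exp.mpr (by linarith)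
    rw [Real.exp_add] at h1
    nlinarith [Real.exp_pos (-s)]
  rcases le_or_gt s 4 with h4 | h4
  · -- `e^{1-s} ≤ 12 e^{-s}/s` since `e s ≤ 12`
    rw [hFun_of_mem (by linarith) (by linarith), hFun_of_three_le h3.le,
      show -(s - 1) = 1 + -s by ring, Real.exp_add]
    rw [show 4 * (3 * Real.exp (-s) / s) = (12 / s) * Real.exp (-s) by ring]
    refine mul_le_mul_of_nonneg_right ?_ (Real.exp_pos _).le
    rw [le_div_iff₀ (by linarith)]
    nlinarith
  · -- `3e^{1-s}/(s-1) ≤ 12 e^{-s}/s` since `e s ≤ 4(s - 1)`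
    rw [hFun_of_three_le (by linarith), hFun_of_three_le (by linarith),
      show -(s - 1) = 1 + -s by ring, Real.exp_add]
    have hs1 : 0 < s - 1 := by linarith
    have hs0 : 0 < s := by linarith
    rw [div_le_iff₀ hs1, show 4 * (3 * Real.exp (-s) / s) * (s - 1) =
      3 * Real.exp (-s) * (4 * (s - 1) / s) by ring]
    have hkey : Real.exp 1 ≤ 4 * (s - 1) / s := by
      rw [le_div_iff₀ hs0]; nlinarith
    nlinarith [Real.exp_pos (-s), Real.exp_pos (1 : ℝ)]

/-- `m_o(s − 1) ≤ 4 h(s)` for `s ≥ 2` (the odd majorant at `s − 1` against the even one at `s`).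
[folklore] -/
theorem moFun_sub_one_le {s : ℝ} (hs : 2 ≤ s) : moFun (s - 1) ≤ 4 * hFun s := by
  rcases le_or_gt s 3 with h3 | h3
  · -- `3e^{-3}/(s-1) ≤ 3e^{-3} ≤ 4e^{-3} ≤ 4e^{-s}`
    rw [moFun_of_mem (by linarith) (by linarith), hFun_of_mem hs h3]
    have hs1 : 1 ≤ s - 1 := by linarith
    have h1 : 3 * Real.exp (-3) / (s - 1) ≤ 3 * Real.exp (-3) :=
      div_le_self (by positivity) hs1
    have h2 : Real.exp (-3) ≤ Real.exp (-s) := Real.exp_le_exp.mpr (by linarith)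
    nlinarith [Real.exp_pos (-3)]
  rcases le_or_gt s 4 with h4 | h4
  · -- `3e^{-3}/(s-1) ≤ 12 e^{-s}/s` iff `s e^{s-3} ≤ 4(s-1)`; use `e^x ≤ 1 + x + x²/2 + 2x³/9`
    rw [moFun_of_mem (by linarith) (by linarith), hFun_of_three_le h3.le]
    have hs1 : 0 < s - 1 := by linarith
    have hs0 : 0 < s := by linarith
    set x := s - 3 with hx
    have hx0 : 0 ≤ x := by linarith
    have hx1 : x ≤ 1 := by linarith
    have hexp := exp_le_cubic hx0 hx1
    have hpoly : (3 + x) * (1 + x + x ^ 2 / 2 + 2 * x ^ 3 / 9) ≤ 4 * (2 + x) := by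
      nlinarith [mul_nonneg hx0 hx0, pow_le_one₀ hx0 hx1 (n := 2), pow_le_one₀ hx0 hx1 (n := 3),
        pow_le_one₀ hx0 hx1 (n := 4), mul_nonneg (mul_nonneg hx0 hx0) hx0,
        mul_nonneg (mul_nonneg (mul_nonneg hx0 hx0) hx0) hx0]
    have hkey : s * Real.exp x ≤ 4 * (s - 1) := by
      have : s * Real.exp x ≤ (3 + x) * (1 + x + x ^ 2 / 2 + 2 * x ^ 3 / 9) := by
        rw [show s = 3 + x by linarith]
        exact mul_le_mul_of_nonneg_left hexp (by linarith)
      linarith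
    have h3x : Real.exp (-3) = Real.exp (-s) * Real.exp x := by
      rw [← Real.exp_add]; congr 1; linarith
    rw [h3x, div_le_iff₀ hs1, show 4 * (3 * Real.exp (-s) / s) * (s - 1) =
      3 * Real.exp (-s) * (4 * (s - 1) / s) by ring]
    have hkey' : Real.exp x ≤ 4 * (s - 1) / s := by rwa [le_div_iff₀ hs0, mul_comm]
    nlinarith [Real.exp_pos (-s), Real.exp_pos x]
  · rw [moFun_eq_hFun (by linarith)]
    exact hFun_sub_one_le hs

/-- `h(s − 1) ≤ 4 m_o(s)` for `s ≥ 3` (there `m_o = h`). [folklore] -/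
theorem hFun_sub_one_le_moFun {s : ℝ} (hs : 3 ≤ s) : hFun (s - 1) ≤ 4 * moFun s := by
  rw [moFun_eq_hFun hs]
  exact hFun_sub_one_le (by linarith)

/-! ### Lemma 9.6: `H(s) ≤ α s h(s)` and `H(3) ≤ α s h(s)` -/

/-- The bound for `∫_{s−1}^T h` on `2 ≤ s ≤ 3`:
`∫_{s−1}^T h ≤ (3 − s) e^{−2} + (e^{−2} − e^{−3}) + (26/33) e^{−3} = (2α + 2 − s) e^{−2}`. [folklore] -/
theorem integral_hFun_le_of_mem {s T : ℝ} (h3 : s ≤ 3) (hT : s - 1 ≤ T) :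
    ∫ t in (s - 1)..T, hFun t ≤ (2 * alphaN + 2 - s) * Real.exp (-2) := by
  set T' := max T 3 with hT'
  have h1 : ∫ t in (s - 1)..T, hFun t ≤ ∫ t in (s - 1)..T', hFun t :=
    integral_le_of_le_of_nonneg continuous_hFun (fun t => (hFun_pos t).le) hT (le_max_left _ _)
  have hsplit : ∫ t in (s - 1)..T', hFun t =
      (∫ t in (s - 1)..2, hFun t) + ((∫ t in (2 : ℝ)..3, hFun t) + ∫ t in (3 : ℝ)..T', hFun t) := by
    rw [intervalIntegral.integral_add_adjacent_intervals (intervalIntegrable_hFun _ _)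
        (intervalIntegrable_hFun _ _),
      intervalIntegral.integral_add_adjacent_intervals (intervalIntegrable_hFun _ _)
        (intervalIntegrable_hFun _ _)]
  have hA : ∫ t in (s - 1)..2, hFun t = (3 - s) * Real.exp (-2) := by
    rw [integral_hFun_of_le_two (by linarith) le_rfl]; ring
  have hB : ∫ t in (2 : ℝ)..3, hFun t = Real.exp (-2) - Real.exp (-3) :=
    integral_hFun_of_mem le_rfl (by norm_num) le_rfl
  have hC : ∫ t in (3 : ℝ)..T', hFun t ≤ 26 / 33 * Real.exp (-3) :=
    integral_hFun_tail_le le_rfl (le_max_right _ _)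
  have hα := two_mul_alphaN_mul_exp
  nlinarith [hsplit, hA, hB, hC, h1]

/-- The key inequality of Lemma 9.6 on `[2, 3]`: `(2α + 2 − s) e^{−2} ≤ α s e^{−s}` (Nathanson:
`H₀(s) = α s h(s) − H(s)` is increasing with `H₀(2) = 0`; here directly from
`e^{−y} ≥ 1/(1 + y + y²/2 + 2y³/9)`, `y = s − 2`, and `α < 1`). [cite: Nathanson1996, Lemma 9.6] -/
theorem bound_le_alphaN_mul {s : ℝ} (h2 : 2 ≤ s) (h3 : s ≤ 3) :
    (2 * alphaN + 2 - s) * Real.exp (-2) ≤ alphaN * s * Real.exp (-s) := by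
  set y := s - 2 with hy
  have hy0 : 0 ≤ y := by linarith
  have hy1 : y ≤ 1 := by linarith
  have hα1 := alphaN_lt_one
  have hα0 := alphaN_pos
  have hQ := inv_cubic_le_exp_neg hy0 hy1
  have hQpos : 0 < 1 + y + y ^ 2 / 2 + 2 * y ^ 3 / 9 := by positivity
  -- polynomial inequality `(2α − y) Q(y) ≤ α (2 + y)`
  have hpoly : (2 * alphaN - y) * (1 + y + y ^ 2 / 2 + 2 * y ^ 3 / 9) ≤ alphaN * (2 + y) := by
    have h1a : 0 ≤ 1 - alphaN := by linarith
    nlinarith [mul_nonneg h1a hy0, mul_nonneg (mul_nonneg h1a hy0) hy0, mul_nonneg hy0 hy0,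
      mul_nonneg (mul_nonneg hy0 hy0) hy0, mul_nonneg (mul_nonneg (mul_nonneg hy0 hy0) hy0) hy0,
      mul_nonneg hα0.le (mul_nonneg (mul_nonneg hy0 hy0) hy0)]
  have hdiv : 2 * alphaN - y ≤ alphaN * (2 + y) * (1 / (1 + y + y ^ 2 / 2 + 2 * y ^ 3 / 9)) := by
    rw [mul_one_div, le_div_iff₀ hQpos]
    exact hpoly
  have hstep : 2 * alphaN - y ≤ alphaN * (2 + y) * Real.exp (-y) :=
    hdiv.trans (mul_le_mul_of_nonneg_left hQ (by positivity))
  have hes : Real.exp (-s) = Real.exp (-2) * Real.exp (-y) := by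
    rw [← Real.exp_add]; congr 1; linarith
  rw [hes, show 2 * alphaN + 2 - s = 2 * alphaN - y by linarith,
    show alphaN * s * (Real.exp (-2) * Real.exp (-y)) =
      Real.exp (-2) * (alphaN * (2 + y) * Real.exp (-y)) by rw [show s = 2 + y by linarith]; ring,
    mul_comm]
  exact mul_le_mul_of_nonneg_left hstep (Real.exp_pos _).le

/-- **Lemma 9.6, first part (finite form): `∫_{s−1}^T h ≤ α s h(s)` for `s ≥ 2`** and every
`T ≥ s − 1` (Nathanson's `H(s) = ∫_s^∞ h(t − 1) dt ≤ α s h(s)`, (9.25), with our `α`).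
[cite: Nathanson1996, Lemma 9.6 (9.25)] -/
theorem integral_hFun_le_alphaN {s T : ℝ} (hs : 2 ≤ s) (hT : s - 1 ≤ T) :
    ∫ t in (s - 1)..T, hFun t ≤ alphaN * s * hFun s := by
  rcases le_or_gt s 3 with h3 | h3
  · rw [hFun_of_mem hs h3]
    exact (integral_hFun_le_of_mem h3 hT).trans (bound_le_alphaN_mul hs h3)
  · -- `s > 3`: `∫_{s-1}^T h ≤ ∫_{s-1}^T e^{-t} dt ≤ e^{1-s} ≤ 3α e^{-s}`
    have h1 : ∫ t in (s - 1)..T, hFun t ≤ ∫ t in (s - 1)..T, Real.exp (-t) :=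
      intervalIntegral.integral_mono_on hT (intervalIntegrable_hFun _ _)
        ((Real.continuous_exp.comp continuous_neg).intervalIntegrable _ _)
        fun t _ => hFun_le_exp_neg t
    rw [integral_exp_neg, hFun_of_three_le h3.le] at *
    have h2 : Real.exp (-(s - 1)) = Real.exp 1 * Real.exp (-s) := by
      rw [← Real.exp_add]; congr 1; ring
    have hα := exp_one_div_three_le_alphaN
    have hs0 : 0 < s := by linarith
    rw [show alphaN * s * (3 * Real.exp (-s) / s) = 3 * alphaN * Real.exp (-s) by field_simp]
    nlinarith [Real.exp_pos (-T), Real.exp_pos (-s)]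

/-- **Lemma 9.6, second part (finite form): `∫_2^T h ≤ α s h(s)` for `1 ≤ s ≤ 3`**, `T ≥ 2`
(Nathanson's `H(3) ≤ α s h(s)`, (9.26)). [cite: Nathanson1996, Lemma 9.6 (9.26)] -/
theorem integral_hFun_two_le_alphaN {s T : ℝ} (h1 : 1 ≤ s) (h3 : s ≤ 3) (hT : 2 ≤ T) :
    ∫ t in (2 : ℝ)..T, hFun t ≤ alphaN * s * hFun s := by
  rcases le_or_gt s 2 with h2 | h2
  · -- `∫_2^T h ≤ (e^{-2} - e^{-3}) + (26/33)e^{-3} = (2α - 1)e^{-2} ≤ α e^{-2} ≤ α s e^{-2}`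
    rw [hFun_of_le_two h2]
    have h := integral_hFun_le_of_mem (s := 3) le_rfl (by linarith : (3 : ℝ) - 1 ≤ T)
    norm_num at h
    have hα1 := alphaN_lt_one
    have hα0 := alphaN_pos
    have hsub : ∫ t in (2 : ℝ)..T, hFun t ≤ (2 * alphaN - 1) * Real.exp (-2) := by
      have : (2 * alphaN + 2 - 3) * Real.exp (-2) = (2 * alphaN - 1) * Real.exp (-2) := by ring
      linarith
    have hfin : (2 * alphaN - 1) * Real.exp (-2) ≤ alphaN * s * Real.exp (-2) :=
      mul_le_mul_of_nonneg_right (by nlinarith) (Real.exp_pos _).le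
    linarith
  · -- `2 < s ≤ 3`: `∫_2^T h ≤ ∫_{s-1}^T h ≤ α s h(s)`
    have hle : ∫ t in (2 : ℝ)..T, hFun t ≤ ∫ t in (s - 1)..T, hFun t := by
      have hadd := intervalIntegral.integral_add_adjacent_intervals (a := s - 1) (b := 2) (c := T)
        (intervalIntegrable_hFun _ _) (intervalIntegrable_hFun _ _)
      have : 0 ≤ ∫ t in (s - 1)..2, hFun t :=
        intervalIntegral.integral_nonneg (by linarith) fun t _ => (hFun_pos t).le
      linarith
    exact hle.trans (integral_hFun_le_alphaN h2.le (by linarith))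

/-! ### The transfer inequalities between the two majorants -/

/-- `(26/33) e ≤ 27/10` (the tails beyond `s ≥ 4`). [folklore] -/
theorem tail_const_le : 26 / 33 * Real.exp 1 ≤ 27 / 10 := by
  have := exp_one_lt_three; nlinarith

/-- **`∫_{s−1}^T m_o ≤ (9/10) s h(s)` for `s ≥ 2`**, `T ≥ s − 1`: the odd majorant feeds the even
step of the induction (the analogue of (9.25) for the pair `(m_o, h)`). [folklore] -/
theorem integral_moFun_le {s T : ℝ} (hs : 2 ≤ s) (hT : s - 1 ≤ T) :
    ∫ t in (s - 1)..T, moFun t ≤ 9 / 10 * s * hFun s := by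
  set T' := max T 3 with hT'
  have hmono : ∫ t in (s - 1)..T, moFun t ≤ ∫ t in (s - 1)..T', moFun t :=
    integral_le_of_le_of_nonneg continuous_moFun (fun t => (moFun_pos t).le) hT (le_max_left _ _)
  refine hmono.trans ?_
  have htail : ∫ t in (3 : ℝ)..T', moFun t ≤ 26 / 33 * Real.exp (-3) :=
    integral_moFun_tail_le le_rfl (le_max_right _ _)
  rcases le_or_gt s 3 with h3 | h3
  · -- `2 ≤ s ≤ 3`: two trapezoids and the tail
    have hsplit : ∫ t in (s - 1)..T', moFun t =
        (∫ t in (s - 1)..2, moFun t) + ((∫ t in (2 : ℝ)..3, moFun t) + ∫ t in (3 : ℝ)..T', moFun t) := by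
      rw [intervalIntegral.integral_add_adjacent_intervals (intervalIntegrable_moFun _ _)
          (intervalIntegrable_moFun _ _),
        intervalIntegral.integral_add_adjacent_intervals (intervalIntegrable_moFun _ _)
          (intervalIntegrable_moFun _ _)]
    have hA := integral_moFun_of_mem_le (a := s - 1) (b := 2) (by linarith) (by linarith) (by norm_num)
    have hB := integral_moFun_of_mem_le (a := 2) (b := 3) (by norm_num) (by norm_num) le_rfl
    rw [hFun_of_mem hs h3]
    -- reduce to a polynomial inequality in `x = 3 - s`
    set x := 3 - s with hx
    have hx0 : 0 ≤ x := by linarith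
    have hx1 : x ≤ 1 := by linarith
    have hexp : 1 + x + x ^ 2 / 2 ≤ Real.exp x := Real.quadratic_le_exp_of_nonneg hx0
    have hes : Real.exp (-s) = Real.exp (-3) * Real.exp x := by
      rw [← Real.exp_add]; congr 1; linarith
    have hs1 : 0 < s - 1 := by linarith
    have hpoly : 3 * ((2 - (s - 1)) * (1 / (s - 1) + 1 / 2) / 2) +
        3 * ((3 - 2) * (1 / (2 : ℝ) + 1 / 3) / 2) + 26 / 33 ≤ 9 / 10 * s * (1 + x + x ^ 2 / 2) := by
      rw [show s - 1 = 2 - x by linarith, show s = 3 - x by linarith]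
      have h2x : 0 < 2 - x := by linarith
      rw [show 3 * ((2 - (2 - x)) * (1 / (2 - x) + 1 / 2) / 2) = 3 * x * (4 - x) / (4 * (2 - x)) by
        field_simp; ring]
      rw [div_add' _ _ _ (by positivity), div_add' _ _ _ (by positivity),
        div_le_iff₀ (by positivity)]
      nlinarith [mul_nonneg hx0 hx0, mul_nonneg (mul_nonneg hx0 hx0) hx0, mul_nonneg hx0 (sub_nonneg.2 hx1),
        mul_nonneg (mul_nonneg hx0 hx0) (sub_nonneg.2 hx1)]
    have hfin : Real.exp (-3) * (9 / 10 * s * (1 + x + x ^ 2 / 2)) ≤ 9 / 10 * s * Real.exp (-s) := by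
      rw [hes, show 9 / 10 * s * (Real.exp (-3) * Real.exp x) = Real.exp (-3) * (9 / 10 * s * Real.exp x)
        by ring]
      refine mul_le_mul_of_nonneg_left (mul_le_mul_of_nonneg_left hexp (by positivity)) (Real.exp_pos _).le
    nlinarith [hsplit, hA, hB, htail, Real.exp_pos (-3 : ℝ), hpoly]
  rcases le_or_gt s 4 with h4 | h4
  · -- `3 < s ≤ 4`: one trapezoid on `[s-1, 3]` and the tail
    have hsplit : ∫ t in (s - 1)..T', moFun t =
        (∫ t in (s - 1)..3, moFun t) + ∫ t in (3 : ℝ)..T', moFun t := by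
      rw [intervalIntegral.integral_add_adjacent_intervals (intervalIntegrable_moFun _ _)
          (intervalIntegrable_moFun _ _)]
    have hA := integral_moFun_of_mem_le (a := s - 1) (b := 3) (by linarith) (by linarith) le_rfl
    rw [hFun_of_three_le h3.le]
    set y := s - 3 with hy
    have hy0 : 0 ≤ y := by linarith
    have hy1 : y ≤ 1 := by linarith
    have hQ := inv_cubic_le_exp_neg hy0 hy1
    have hQpos : 0 < 1 + y + y ^ 2 / 2 + 2 * y ^ 3 / 9 := by positivity
    have hes : Real.exp (-s) = Real.exp (-3) * Real.exp (-y) := by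
      rw [← Real.exp_add]; congr 1; linarith
    have hs0 : 0 < s := by linarith
    have hpoly : (3 * ((3 - (s - 1)) * (1 / (s - 1) + 1 / 3) / 2) + 26 / 33) *
        (1 + y + y ^ 2 / 2 + 2 * y ^ 3 / 9) ≤ 27 / 10 := by
      rw [show s - 1 = 2 + y by linarith]
      have h2y : 0 < 2 + y := by linarith
      rw [show 3 * ((3 - (2 + y)) * (1 / (2 + y) + 1 / 3) / 2) = (1 - y) * (5 + y) / (2 * (2 + y)) by
        field_simp; ring]
      rw [div_add' _ _ _ (by positivity), div_mul_eq_mul_div, div_le_iff₀ (by positivity)]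
      nlinarith [mul_nonneg hy0 hy0, mul_nonneg (mul_nonneg hy0 hy0) hy0, mul_nonneg hy0 (sub_nonneg.2 hy1),
        mul_nonneg (mul_nonneg hy0 hy0) (sub_nonneg.2 hy1),
        mul_nonneg (mul_nonneg (mul_nonneg hy0 hy0) hy0) (sub_nonneg.2 hy1),
        mul_nonneg (mul_nonneg (mul_nonneg hy0 hy0) hy0) hy0]
    have hstep : 3 * ((3 - (s - 1)) * (1 / (s - 1) + 1 / 3) / 2) + 26 / 33 ≤ 27 / 10 * Real.exp (-y) := by
      have h1 : 3 * ((3 - (s - 1)) * (1 / (s - 1) + 1 / 3) / 2) + 26 / 33 ≤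
          27 / 10 * (1 / (1 + y + y ^ 2 / 2 + 2 * y ^ 3 / 9)) := by
        rw [mul_one_div, le_div_iff₀ hQpos]; exact hpoly
      exact h1.trans (mul_le_mul_of_nonneg_left hQ (by norm_num))
    rw [show 9 / 10 * s * (3 * Real.exp (-s) / s) = Real.exp (-3) * (27 / 10 * Real.exp (-y)) by
      rw [hes]; field_simp; norm_num]
    nlinarith [hsplit, hA, htail, Real.exp_pos (-3 : ℝ), hstep,
      mul_le_mul_of_nonneg_left hstep (Real.exp_pos (-3 : ℝ)).le]
  · -- `s > 4`: the tail only
    have h1 : ∫ t in (s - 1)..T', moFun t ≤ 26 / 33 * Real.exp (-(s - 1)) :=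
      integral_moFun_tail_le (by linarith) ((hT.trans (le_max_left _ _)))
    rw [hFun_of_three_le (by linarith)]
    have hs0 : 0 < s := by linarith
    rw [show 9 / 10 * s * (3 * Real.exp (-s) / s) = 27 / 10 * Real.exp (-s) by field_simp; norm_num]
    have h2 : Real.exp (-(s - 1)) = Real.exp 1 * Real.exp (-s) := by
      rw [← Real.exp_add]; congr 1; ring
    rw [h2] at h1
    nlinarith [tail_const_le, Real.exp_pos (-s)]

/-- **`∫_{s−1}^T h ≤ (9/10) s m_o(s)` for `s ≥ 3`**, `T ≥ s − 1`: the even majorant feeds the odd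
step of the induction (for `s ≥ 3` Nathanson's bound `H(s) ≤ e^{1−s}` already gives the constant
`e/3`; here with the tail bound, `e − 7/33 ≤ 27/10`). [folklore] -/
theorem integral_hFun_le_moFun {s T : ℝ} (hs : 3 ≤ s) (hT : s - 1 ≤ T) :
    ∫ t in (s - 1)..T, hFun t ≤ 9 / 10 * s * moFun s := by
  set T' := max T 3 with hT'
  have hmono : ∫ t in (s - 1)..T, hFun t ≤ ∫ t in (s - 1)..T', hFun t :=
    integral_le_of_le_of_nonneg continuous_hFun (fun t => (hFun_pos t).le) hT (le_max_left _ _)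
  refine hmono.trans ?_
  have hs0 : 0 < s := by linarith
  rw [moFun_of_three_le hs, show 9 / 10 * s * (3 * Real.exp (-s) / s) = 27 / 10 * Real.exp (-s) by
    field_simp; norm_num]
  rcases le_or_gt s 4 with h4 | h4
  · have hsplit : ∫ t in (s - 1)..T', hFun t =
        (∫ t in (s - 1)..3, hFun t) + ∫ t in (3 : ℝ)..T', hFun t := by
      rw [intervalIntegral.integral_add_adjacent_intervals (intervalIntegrable_hFun _ _)
          (intervalIntegrable_hFun _ _)]
    have hA : ∫ t in (s - 1)..3, hFun t = Real.exp (-(s - 1)) - Real.exp (-3) :=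
      integral_hFun_of_mem (by linarith) (by linarith) le_rfl
    have htail : ∫ t in (3 : ℝ)..T', hFun t ≤ 26 / 33 * Real.exp (-3) :=
      integral_hFun_tail_le le_rfl (le_max_right _ _)
    have h2 : Real.exp (-(s - 1)) = Real.exp 1 * Real.exp (-s) := by
      rw [← Real.exp_add]; congr 1; ring
    have h3 : Real.exp (-s) ≤ Real.exp (-3) := Real.exp_le_exp.mpr (by linarith)
    have k1 : ∫ t in (s - 1)..T', hFun t ≤
        Real.exp 1 * Real.exp (-s) - Real.exp (-3) + 26 / 33 * Real.exp (-3) := by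
      rw [hsplit, hA, h2]; linarith
    have k2 : Real.exp 1 * Real.exp (-s) - Real.exp (-3) + 26 / 33 * Real.exp (-3) ≤
        (Real.exp 1 - 7 / 33) * Real.exp (-s) := by linarith
    have k3 : (Real.exp 1 - 7 / 33) * Real.exp (-s) ≤ 27 / 10 * Real.exp (-s) :=
      mul_le_mul_of_nonneg_right (by linarith [Real.exp_one_lt_d9]) (Real.exp_pos _).le
    linarith
  · have h1 : ∫ t in (s - 1)..T', hFun t ≤ 26 / 33 * Real.exp (-(s - 1)) :=
      integral_hFun_tail_le (by linarith) ((hT.trans (le_max_left _ _)))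
    have h2 : Real.exp (-(s - 1)) = Real.exp 1 * Real.exp (-s) := by
      rw [← Real.exp_add]; congr 1; ring
    rw [h2] at h1
    nlinarith [tail_const_le, Real.exp_pos (-s)]

end JurkatRichert

end Literature.NumberTheory.Sieve
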